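import Summits.SmoothPoincare4.SmoothPoincare4.Theorems.DottedCircleRasmussenDcrGapHelperFriendsCarrierVkPartCRegion
import Literature.Topology.FourManifolds.SmoothEmbeddingCriteria

/-!
# Helper `helper_friendsCarrier_Vk_partC` (V_k part C: the collar of the uninverted model disc exterior) —
# piece 5: smoothness of the collar
(item stmt-SmoothPoincare4-16128, route route-SmoothPoincare4-DottedCircleRasmussen)

Fifth piece of the port of the tree's `SliceDiscEndCollar.lean` to `M_k ⊂ ℝ⁴` (definitions in
`…VkPartCDatum`; `…VkPartCChart`, `…Formulas`, `…Region`):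

* the three collar formulas are smooth in coordinates: the shell formula `(a, σ) ↦ Φ(Einv s₀ e^{-σ}, a)`
  on `ℝ⁴ × ℝ` (no sphere: simpler than the template), the tube formula `fP` in tube coordinates where
  `0 < ‖w‖ < 2` and the flat formula where `‖p‖ < 1/4` (the template's proofs, verbatim);
* agreement of the formulas on the overlaps: shell = tube over `ν(u, w)`, `1 ≤ ‖w‖ < 2` (right regime of
  `Ψ⁻¹`), tube = flat for `0 < ‖p‖ ≤ (1 - s₀)/4` (deep regime);
* the `Y`-side smoothness of a presentation `Q : V.Pres Y`: images under `jM` of relatively open subsets of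
  `M_k ∖ K₁` are open, `invB` is smooth on `range jB`, `ι ∘ ψ` is smooth on the tube part (flow-out tube of `ν`);
* **the collar is `C^∞`** (`Pres.contMDiff_collar`): on the open cover tube part / shell part / flat part of
  `Y × ℝ` it is one of the three smooth formulas; `helper_friendsCarrier_Vk_partC_smooth` — the registered summary.

Everything is proved; no definitions, no named facts, no `sorry`.  References: Manolescu–Piccirillo (2023),
§3.2 [ManolescuPiccirillo2023]; Kirby (1989), Ch. I §5 [Kirby1989].
-/

-- the prescribed namespace `Summit.<P>.<Sub>.…` duplicates `SmoothPoincare4` (P = Sub)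
set_option linter.dupNamespace false
set_option linter.style.longLine false

noncomputable section

open scoped Manifold ContDiff Topology
open Function Set Metric
open Literature.Topology.FourManifolds Literature.Topology.FourManifolds.MMSW

namespace Summit.SmoothPoincare4.SmoothPoincare4.Theorems.DcrGap.MkFriends

namespace FriendsVk

namespace CollarDatum

variable {k : ℕ} (V : CollarDatum k)

/-! ### Smoothness of the three collar formulas in coordinates -/

/-- The depth `σ ↦ Einv c (e^{-σ})` of the collar height is smooth (`c > 0`). [folklore] -/
theorem _root_.Summit.SmoothPoincare4.SmoothPoincare4.Theorems.DcrGap.MkFriends.FriendsVk.contDiff_Einv_exp {c : ℝ} (hc : 0 < c) : ContDiff ℝ ∞ fun σ : ℝ => SliceCollar.Einv c (Real.exp (-σ)) := by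
  rw [contDiff_iff_contDiffAt]
  intro σ
  have he : ContDiffAt ℝ ∞ (fun σ : ℝ => Real.exp (-σ)) σ := (Real.contDiff_exp.comp contDiff_neg).contDiffAt
  exact ContDiffAt.comp (g := SliceCollar.Einv c) (f := fun σ : ℝ => Real.exp (-σ)) σ (SliceCollar.contDiffAt_Einv hc (Real.exp_pos _)) he

/-- **The shell formula is smooth** on `ℝ⁴ × ℝ`. [folklore] -/
theorem contDiff_cRad : ContDiff ℝ ∞ fun q : (EuclideanSpace ℝ (Fin 4)) × ℝ => V.cRad q.1 q.2 :=
  V.contDiff_Φ.comp (((contDiff_Einv_exp V.s₀_pos).comp contDiff_snd).prodMk contDiff_fst)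

/-- The tube formula is `fP` in tube coordinates (definitionally). [folklore] -/
theorem cTube_eq_fP (a : EuclideanSpace ℝ (Fin 4)) (σ : ℝ) : V.cTube a σ = V.fP (V.ι a, σ) := rfl

/-- **The tube formula is smooth** in tube coordinates where `0 < ‖w‖ < 2` (`ConicalDiscTube.fPdom`). [folklore] -/
theorem contMDiffOn_fP : ContMDiffOn (((𝓡 1).prod 𝓘(ℝ, EuclideanSpace ℝ (Fin 2))).prod 𝓘(ℝ, ℝ)) 𝓘(ℝ, EuclideanSpace ℝ (Fin 4)) ∞ V.fP ConicalDiscTube.fPdom := by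
  haveI : Fact (Module.finrank ℝ (EuclideanSpace ℝ (Fin 2)) = 1 + 1) := ⟨by simp⟩
  rintro q ⟨hq, hq2⟩
  -- the profile coordinates
  have hstrip : (‖q.1.2‖, q.2) ∈ SliceCollar.Strip := ⟨⟨norm_pos_iff.2 hq, hq2⟩, mem_univ _⟩
  have hbase : ContMDiffAt (((𝓡 1).prod 𝓘(ℝ, EuclideanSpace ℝ (Fin 2))).prod 𝓘(ℝ, ℝ)) 𝓘(ℝ, ℝ × ℝ) ∞
      (fun q : ((Metric.sphere (0 : EuclideanSpace ℝ (Fin 2)) 1) × (EuclideanSpace ℝ (Fin 2))) × ℝ => SliceCollar.Ψinv V.s₀ (‖q.1.2‖, q.2)) q := by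
    have h1 : ContMDiffAt (((𝓡 1).prod 𝓘(ℝ, EuclideanSpace ℝ (Fin 2))).prod 𝓘(ℝ, ℝ)) 𝓘(ℝ, ℝ) ∞
        (fun q : ((Metric.sphere (0 : EuclideanSpace ℝ (Fin 2)) 1) × (EuclideanSpace ℝ (Fin 2))) × ℝ => ‖q.1.2‖) q :=
      (contDiffAt_norm ℝ hq).contMDiffAt.comp q (contMDiff_snd.comp contMDiff_fst).contMDiffAt
    have h2 : ContMDiffAt (((𝓡 1).prod 𝓘(ℝ, EuclideanSpace ℝ (Fin 2))).prod 𝓘(ℝ, ℝ)) 𝓘(ℝ, ℝ) ∞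
        (fun q : ((Metric.sphere (0 : EuclideanSpace ℝ (Fin 2)) 1) × (EuclideanSpace ℝ (Fin 2))) × ℝ => q.2) q := contMDiff_snd.contMDiffAt
    exact ContMDiffAt.comp (g := SliceCollar.Ψinv V.s₀) (f := fun q : ((Metric.sphere (0 : EuclideanSpace ℝ (Fin 2)) 1) × (EuclideanSpace ℝ (Fin 2))) × ℝ => (‖q.1.2‖, q.2)) q
      (SliceCollar.contDiffAt_Ψinv V.s₀_pos V.depth₀_lt_one hstrip).contMDiffAt (h1.prodMk_space h2)
  have hP := SliceCollar.Ψinv_mem V.s₀_pos V.depth₀_lt_one hstrip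
  obtain ⟨hℓ0, hℓ1, hr0, hr2, -⟩ := SliceCollar.mem_P_iff.1 hP
  -- the two arguments of `G`
  have hx : ContMDiffAt (((𝓡 1).prod 𝓘(ℝ, EuclideanSpace ℝ (Fin 2))).prod 𝓘(ℝ, ℝ)) 𝓘(ℝ, EuclideanSpace ℝ (Fin 2)) ∞
      (fun q : ((Metric.sphere (0 : EuclideanSpace ℝ (Fin 2)) 1) × (EuclideanSpace ℝ (Fin 2))) × ℝ =>
        (1 - (SliceCollar.Ψinv V.s₀ (‖q.1.2‖, q.2)).1) • ((q.1.1 : Metric.sphere (0 : EuclideanSpace ℝ (Fin 2)) 1) : EuclideanSpace ℝ (Fin 2))) q := by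
    have hs : ContMDiffAt (((𝓡 1).prod 𝓘(ℝ, EuclideanSpace ℝ (Fin 2))).prod 𝓘(ℝ, ℝ)) 𝓘(ℝ, ℝ) ∞
        (fun q : ((Metric.sphere (0 : EuclideanSpace ℝ (Fin 2)) 1) × (EuclideanSpace ℝ (Fin 2))) × ℝ => 1 - (SliceCollar.Ψinv V.s₀ (‖q.1.2‖, q.2)).1) q :=
      ContMDiffAt.comp (g := fun r : ℝ × ℝ => 1 - r.1) (f := fun q : ((Metric.sphere (0 : EuclideanSpace ℝ (Fin 2)) 1) × (EuclideanSpace ℝ (Fin 2))) × ℝ => SliceCollar.Ψinv V.s₀ (‖q.1.2‖, q.2)) q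
        (contDiffAt_const.sub contDiffAt_fst).contMDiffAt hbase
    have hu : ContMDiffAt (((𝓡 1).prod 𝓘(ℝ, EuclideanSpace ℝ (Fin 2))).prod 𝓘(ℝ, ℝ)) 𝓘(ℝ, EuclideanSpace ℝ (Fin 2)) ∞
        (fun q : ((Metric.sphere (0 : EuclideanSpace ℝ (Fin 2)) 1) × (EuclideanSpace ℝ (Fin 2))) × ℝ => ((q.1.1 : Metric.sphere (0 : EuclideanSpace ℝ (Fin 2)) 1) : EuclideanSpace ℝ (Fin 2))) q :=
      ((contMDiff_coe_sphere (E := EuclideanSpace ℝ (Fin 2)) (n := 1)).comp (contMDiff_fst.comp contMDiff_fst)).contMDiffAt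
    exact (TubeNbhd.contDiff_smul_pair (EuclideanSpace ℝ (Fin 2))).contMDiff.contMDiffAt.comp q (hs.prodMk_space hu)
  have hw : ContMDiffAt (((𝓡 1).prod 𝓘(ℝ, EuclideanSpace ℝ (Fin 2))).prod 𝓘(ℝ, ℝ)) 𝓘(ℝ, EuclideanSpace ℝ (Fin 2)) ∞
      (fun q : ((Metric.sphere (0 : EuclideanSpace ℝ (Fin 2)) 1) × (EuclideanSpace ℝ (Fin 2))) × ℝ =>
        (SliceCollar.Ψinv V.s₀ (‖q.1.2‖, q.2)).2 • ((radialProjection (spherePt 1) q.1.2 : Metric.sphere (0 : EuclideanSpace ℝ (Fin 2)) 1) : EuclideanSpace ℝ (Fin 2))) q := by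
    have hs : ContMDiffAt (((𝓡 1).prod 𝓘(ℝ, EuclideanSpace ℝ (Fin 2))).prod 𝓘(ℝ, ℝ)) 𝓘(ℝ, ℝ) ∞
        (fun q : ((Metric.sphere (0 : EuclideanSpace ℝ (Fin 2)) 1) × (EuclideanSpace ℝ (Fin 2))) × ℝ => (SliceCollar.Ψinv V.s₀ (‖q.1.2‖, q.2)).2) q :=
      ContMDiffAt.comp (g := fun r : ℝ × ℝ => r.2) (f := fun q : ((Metric.sphere (0 : EuclideanSpace ℝ (Fin 2)) 1) × (EuclideanSpace ℝ (Fin 2))) × ℝ => SliceCollar.Ψinv V.s₀ (‖q.1.2‖, q.2)) q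
        contDiffAt_snd.contMDiffAt hbase
    have hv : ContMDiffAt (((𝓡 1).prod 𝓘(ℝ, EuclideanSpace ℝ (Fin 2))).prod 𝓘(ℝ, ℝ)) 𝓘(ℝ, EuclideanSpace ℝ (Fin 2)) ∞
        (fun q : ((Metric.sphere (0 : EuclideanSpace ℝ (Fin 2)) 1) × (EuclideanSpace ℝ (Fin 2))) × ℝ => ((radialProjection (spherePt 1) q.1.2 : Metric.sphere (0 : EuclideanSpace ℝ (Fin 2)) 1) : EuclideanSpace ℝ (Fin 2))) q := by
      have hr : ContMDiffAt 𝓘(ℝ, EuclideanSpace ℝ (Fin 2)) (𝓡 1) ∞ (radialProjection (spherePt 1)) q.1.2 :=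
        (contMDiffOn_radialProjection (spherePt 1)).contMDiffAt (isOpen_ne.mem_nhds hq)
      exact (contMDiff_coe_sphere (E := EuclideanSpace ℝ (Fin 2)) (n := 1)).contMDiffAt.comp q (hr.comp q (contMDiff_snd.comp contMDiff_fst).contMDiffAt)
    exact (TubeNbhd.contDiff_smul_pair (EuclideanSpace ℝ (Fin 2))).contMDiff.contMDiffAt.comp q (hs.prodMk_space hv)
  -- the argument lies in the domain of `G`
  have hdom : (((1 - (SliceCollar.Ψinv V.s₀ (‖q.1.2‖, q.2)).1) • ((q.1.1 : Metric.sphere (0 : EuclideanSpace ℝ (Fin 2)) 1) : EuclideanSpace ℝ (Fin 2)),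
      (SliceCollar.Ψinv V.s₀ (‖q.1.2‖, q.2)).2 • ((radialProjection (spherePt 1) q.1.2 : Metric.sphere (0 : EuclideanSpace ℝ (Fin 2)) 1) : EuclideanSpace ℝ (Fin 2))) :
        (EuclideanSpace ℝ (Fin 2)) × (EuclideanSpace ℝ (Fin 2))) ∈ (ConicalDiscTube.dom : Set ((EuclideanSpace ℝ (Fin 2)) × (EuclideanSpace ℝ (Fin 2)))) :=
    ConicalDiscTube.ptB_arg_mem_dom hℓ0 hℓ1 (by rw [abs_of_pos hr0]; exact hr2) _ _
  exact (ContMDiffAt.comp (g := V.G) q (V.contDiffAt_G hdom).contMDiffAt (hx.prodMk_space hw)).contMDiffWithinAt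

/-- **The flat formula is smooth** where `‖p‖ < 1/4`. [folklore] -/
theorem contMDiffOn_cFlat : ContMDiffOn ((𝓘(ℝ, EuclideanSpace ℝ (Fin 2)).prod (𝓡 1)).prod 𝓘(ℝ, ℝ)) 𝓘(ℝ, EuclideanSpace ℝ (Fin 4)) ∞
    (fun q : ((EuclideanSpace ℝ (Fin 2)) × (Metric.sphere (0 : EuclideanSpace ℝ (Fin 2)) 1)) × ℝ => V.cFlat q.1 q.2)
    {q | ‖q.1.1‖ < 4⁻¹} := by
  haveI : Fact (Module.finrank ℝ (EuclideanSpace ℝ (Fin 2)) = 1 + 1) := ⟨by simp⟩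
  intro q hq
  have hq' : ‖q.1.1‖ < 4⁻¹ := hq
  have hr := SliceCollar.Einv_mem one_pos (Real.exp (-q.2))
  have hp : ContMDiffAt ((𝓘(ℝ, EuclideanSpace ℝ (Fin 2)).prod (𝓡 1)).prod 𝓘(ℝ, ℝ)) 𝓘(ℝ, EuclideanSpace ℝ (Fin 2)) ∞
      (fun q : ((EuclideanSpace ℝ (Fin 2)) × (Metric.sphere (0 : EuclideanSpace ℝ (Fin 2)) 1)) × ℝ => (4 : ℝ) • q.1.1) q :=
    ((contDiff_const_smul (4 : ℝ)).contMDiff.comp (contMDiff_fst.comp contMDiff_fst)).contMDiffAt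
  have hw : ContMDiffAt ((𝓘(ℝ, EuclideanSpace ℝ (Fin 2)).prod (𝓡 1)).prod 𝓘(ℝ, ℝ)) 𝓘(ℝ, EuclideanSpace ℝ (Fin 2)) ∞
      (fun q : ((EuclideanSpace ℝ (Fin 2)) × (Metric.sphere (0 : EuclideanSpace ℝ (Fin 2)) 1)) × ℝ =>
        SliceCollar.Einv 1 (Real.exp (-q.2)) • ((q.1.2 : Metric.sphere (0 : EuclideanSpace ℝ (Fin 2)) 1) : EuclideanSpace ℝ (Fin 2))) q := by
    have hs : ContMDiffAt ((𝓘(ℝ, EuclideanSpace ℝ (Fin 2)).prod (𝓡 1)).prod 𝓘(ℝ, ℝ)) 𝓘(ℝ, ℝ) ∞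
        (fun q : ((EuclideanSpace ℝ (Fin 2)) × (Metric.sphere (0 : EuclideanSpace ℝ (Fin 2)) 1)) × ℝ => SliceCollar.Einv 1 (Real.exp (-q.2))) q :=
      (contDiff_Einv_exp one_pos).contDiffAt.contMDiffAt.comp q contMDiff_snd.contMDiffAt
    have hv : ContMDiffAt ((𝓘(ℝ, EuclideanSpace ℝ (Fin 2)).prod (𝓡 1)).prod 𝓘(ℝ, ℝ)) 𝓘(ℝ, EuclideanSpace ℝ (Fin 2)) ∞
        (fun q : ((EuclideanSpace ℝ (Fin 2)) × (Metric.sphere (0 : EuclideanSpace ℝ (Fin 2)) 1)) × ℝ => ((q.1.2 : Metric.sphere (0 : EuclideanSpace ℝ (Fin 2)) 1) : EuclideanSpace ℝ (Fin 2))) q :=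
      ((contMDiff_coe_sphere (E := EuclideanSpace ℝ (Fin 2)) (n := 1)).comp (contMDiff_snd.comp contMDiff_fst)).contMDiffAt
    exact (TubeNbhd.contDiff_smul_pair (EuclideanSpace ℝ (Fin 2))).contMDiff.contMDiffAt.comp q (hs.prodMk_space hv)
  have hdom : (((4 : ℝ) • q.1.1, SliceCollar.Einv 1 (Real.exp (-q.2)) • ((q.1.2 : Metric.sphere (0 : EuclideanSpace ℝ (Fin 2)) 1) : EuclideanSpace ℝ (Fin 2))) :
      (EuclideanSpace ℝ (Fin 2)) × (EuclideanSpace ℝ (Fin 2))) ∈ (ConicalDiscTube.dom : Set ((EuclideanSpace ℝ (Fin 2)) × (EuclideanSpace ℝ (Fin 2)))) := by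
    refine ConicalDiscTube.mem_dom_iff.2 ⟨?_, ?_⟩
    · simp only; rw [norm_smul, Real.norm_of_nonneg (by norm_num : (0 : ℝ) ≤ 4)]; linarith
    · simp only; rw [norm_smul_coe_sphere hr.1.le]; linarith [hr.2]
  exact (ContMDiffAt.comp (g := V.G) q (V.contDiffAt_G hdom).contMDiffAt (hp.prodMk_space hw)).contMDiffWithinAt

/-! ### Agreement of the collar formulas on overlaps -/

/-- **Shell = tube on the overlap**: over `ν (u, w)` with `1 ≤ ‖w‖ < 2` (right regime of `Ψ⁻¹`). [folklore] -/
theorem cRad_eq_cTube (u : Metric.sphere (0 : EuclideanSpace ℝ (Fin 2)) 1) {w : EuclideanSpace ℝ (Fin 2)} (hw1 : 1 ≤ ‖w‖) (hw2 : ‖w‖ < 2) (σ : ℝ) :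
    V.cRad (V.ν (u, w)) σ = V.cTube (V.ν (u, w)) σ := by
  have hwpos : 0 < ‖w‖ := by linarith
  have hℓ := SliceCollar.Einv_mem V.s₀_pos (Real.exp (-σ))
  rw [V.cTube_apply, V.baseP_apply, SliceCollar.Ψinv_of_one_le V.s₀_pos V.depth₀_lt_one (q := (‖w‖, σ)) hw1 hw2]
  simp only
  rw [V.ptB_of_lt hℓ.1 (hℓ.2.trans V.s₀_lt) (by rw [abs_of_pos hwpos]; exact hw2), norm_smul_coe_radialProjection, CollarDatum.cRad]

/-- **Tube = flat on the overlap**: for `0 < ‖p‖ ≤ (1 - s₀)/4` the tube formula at `ν (p̂, ‖p‖ v)` is the flat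
formula at `(p, v)` (deep regime of `Ψ⁻¹`). [folklore] -/
theorem cTube_eq_cFlat {pv : EuclideanSpace ℝ (Fin 2)} (hp : pv ≠ 0) (hp1 : ‖pv‖ ≤ (1 - V.s₀) / 4) (v : Metric.sphere (0 : EuclideanSpace ℝ (Fin 2)) 1) (σ : ℝ) :
    V.cTube (V.ν (radialProjection (spherePt 1) pv, ‖pv‖ • (v : EuclideanSpace ℝ (Fin 2)))) σ = V.cFlat (pv, v) σ := by
  have hppos : 0 < ‖pv‖ := norm_pos_iff.2 hp
  have hn : ‖‖pv‖ • (v : EuclideanSpace ℝ (Fin 2))‖ = ‖pv‖ := norm_smul_coe_sphere hppos.le _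
  rw [V.cTube_apply, V.baseP_apply, hn, SliceCollar.Ψinv_of_le V.s₀_pos V.depth₀_lt_one (q := (‖pv‖, σ)) hppos
    (by rw [SliceCollar.T]; exact hp1)]
  simp only
  rw [radialProjection_smul _ hppos, CollarDatum.ptB, CollarDatum.cFlat]
  congr 2
  rw [sub_sub_cancel, coe_radialProjection_of_ne_zero _ hp, smul_smul]
  field_simp

/-! ### Smoothness on the `Y`-side -/

/-- The flow-out tube of `ν` of fibre radius `< 2` (an open set of `ℝ⁴` cutting `M_k` in `ν(𝕊¹ × B(0,2))`). [folklore] -/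
theorem isOpen_flowTube_two : IsOpen {y : EuclideanSpace ℝ (Fin 4) | y ∈ {y : EuclideanSpace ℝ (Fin 4) | (∀ j, (1 : ℝ) / 2 < holeTerm k j y) ∧
    levelFun k y ∈ Ioo (1 - 2 * V.ε) (1 + 2 * V.ε) ∧ V.Φ (1 - levelFun k y, y) ∈ range V.ν} ∧ ‖(V.ι y).2‖ < 2} :=
  (continuous_norm.comp_continuousOn (continuous_snd.comp_continuousOn V.contMDiffOn_ι.continuousOn)).isOpen_inter_preimage
    V.isOpen_flowTube isOpen_Iio

namespace Pres

variable {V} {Y : Type*} [TopologicalSpace Y] [ChartedSpace (EuclideanSpace ℝ (Fin 3)) Y] (Q : V.Pres Y)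

/-- **Images under `jM` of relatively open subsets of `M_k ∖ K₁` are open in `Y`.** [folklore] -/
theorem isOpen_image_jM {U : Set (EuclideanSpace ℝ (Fin 4))} (hU : IsOpen U) :
    IsOpen (Q.jM '' {a | a ∈ modelBoundary k ∧ a ∉ range V.K₁ ∧ a ∈ U}) := by
  have heq : Q.jM '' {a | a ∈ modelBoundary k ∧ a ∉ range V.K₁ ∧ a ∈ U} = V.mSet Q.jM ∩ Q.ψ ⁻¹' U := by
    ext y
    constructor
    · rintro ⟨a, ⟨ha, ha', haU⟩, rfl⟩
      exact ⟨⟨a, ⟨ha, ha'⟩, rfl⟩, by show Q.ψ (Q.jM a) ∈ U; rwa [Q.ψ_jM a ha ha']⟩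
    · rintro ⟨⟨a, ⟨ha, ha'⟩, rfl⟩, hU'⟩
      refine ⟨a, ⟨ha, ha', ?_⟩, rfl⟩
      have : Q.ψ (Q.jM a) ∈ U := hU'
      rwa [Q.ψ_jM a ha ha'] at this
  rw [heq]
  exact Q.contMDiffOn_ψ.continuousOn.isOpen_inter_preimage Q.isOpen_mSet hU

/-- The tube part of `Y` through the flow-out tube. [folklore] -/
theorem tubeSet_eq : V.tubeSet Q.jM = Q.jM '' {a | a ∈ modelBoundary k ∧ a ∉ range V.K₁ ∧ a ∈
    {y : EuclideanSpace ℝ (Fin 4) | y ∈ {y : EuclideanSpace ℝ (Fin 4) | (∀ j, (1 : ℝ) / 2 < holeTerm k j y) ∧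
      levelFun k y ∈ Ioo (1 - 2 * V.ε) (1 + 2 * V.ε) ∧ V.Φ (1 - levelFun k y, y) ∈ range V.ν} ∧ ‖(V.ι y).2‖ < 2}} := by
  rw [CollarDatum.tubeSet]
  congr 1
  ext a
  constructor
  · rintro ⟨ha, ha', ⟨⟨u, w⟩, ⟨-, hw⟩, rfl⟩⟩
    rw [mem_ball, dist_zero_right] at hw
    exact ⟨ha, ha', (V.mem_flowTube_iff_of_mem ha).2 (mem_range_self _), by rwa [V.ι_ν]⟩
  · rintro ⟨ha, ha', h, hlt⟩
    obtain ⟨⟨u, w⟩, hq⟩ := (V.mem_flowTube_iff_of_mem ha).1 h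
    refine ⟨ha, ha', ⟨(u, w), ⟨mem_univ _, ?_⟩, hq⟩⟩
    rw [mem_ball, dist_zero_right]
    rwa [← hq, V.ι_ν] at hlt

/-- The tube part of `Y` is open. [folklore] -/
theorem isOpen_tubeSet : IsOpen (V.tubeSet Q.jM) := by
  rw [Q.tubeSet_eq]; exact Q.isOpen_image_jM V.isOpen_flowTube_two

/-- The shell part of `Y` is open. [folklore] -/
theorem isOpen_radSet : IsOpen (V.radSet Q.jM) := by
  have heq : V.radSet Q.jM = Q.jM '' {a | a ∈ modelBoundary k ∧ a ∉ range V.K₁ ∧ a ∈ (V.unitTube)ᶜ} := by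
    rw [CollarDatum.radSet]
    congr 1
    ext a
    constructor
    · rintro ⟨ha, hat⟩; exact ⟨ha, fun h => hat (V.range_subset_unitTube h), hat⟩
    · rintro ⟨ha, -, hat⟩; exact ⟨ha, hat⟩
  rw [heq]
  exact Q.isOpen_image_jM V.isClosed_unitTube.isOpen_compl

/-- `jB` is an open embedding. [folklore] -/
theorem isOpenEmbedding_jB : Topology.IsOpenEmbedding Q.jB := ⟨Q.jB_emb.isEmbedding, Q.isOpen_range_jB⟩

/-- `invB : Y → ℝ² × 𝕊¹` is smooth on `range jB`. [folklore] -/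
theorem contMDiffOn_invB : ContMDiffOn (𝓡 3) (𝓘(ℝ, EuclideanSpace ℝ (Fin 2)).prod (𝓡 1)) ∞ (TubeNbhd.invB Q.jB) (range Q.jB) := by
  have h := contMDiffOn_symm_of_isSmoothEmbedding Q.jB_emb Q.isOpenEmbedding_jB
  refine contMDiff_subtype_val.comp_contMDiffOn (h.congr ?_)
  rintro _ ⟨b, rfl⟩
  rw [Function.leftInverse_invFun Q.injective_jB b]
  exact (Q.isOpenEmbedding_jB.toOpenPartialHomeomorph_left_inv (x := b)).symm

/-- `jM` is smooth at points of `M_k ∖ K₁`. [folklore] -/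
theorem contMDiffAt_jM {a : EuclideanSpace ℝ (Fin 4)} (ha : a ∈ modelBoundary k) (ha' : a ∉ range V.K₁) :
    ContMDiffAt 𝓘(ℝ, EuclideanSpace ℝ (Fin 4)) (𝓡 3) ∞ Q.jM a :=
  Q.contMDiffOn_jM.contMDiffAt (Q.isOpen_W.mem_nhds (Q.mem_W a ha ha'))

/-- `ψ` is smooth at points of the `M_k`-part. [folklore] -/
theorem contMDiffAt_ψ {y : Y} (hy : y ∈ V.mSet Q.jM) : ContMDiffAt (𝓡 3) 𝓘(ℝ, EuclideanSpace ℝ (Fin 4)) ∞ Q.ψ y :=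
  Q.contMDiffOn_ψ.contMDiffAt (Q.isOpen_mSet.mem_nhds hy)

/-- **Tube coordinates `ι ∘ ψ` are smooth on the tube part of `Y`.** [folklore] -/
theorem contMDiffOn_coords : ContMDiffOn (𝓡 3) ((𝓡 1).prod 𝓘(ℝ, EuclideanSpace ℝ (Fin 2))) ∞ (fun y => V.ι (Q.ψ y)) (V.tubeSet Q.jM) := by
  refine V.contMDiffOn_ι.comp (Q.contMDiffOn_ψ.mono ?_) ?_
  · rintro _ ⟨a, ⟨ha, ha', -⟩, rfl⟩; exact ⟨a, ⟨ha, ha'⟩, rfl⟩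
  · rintro _ ⟨a, ⟨ha, ha', hat⟩, rfl⟩
    show Q.ψ (Q.jM a) ∈ {y : EuclideanSpace ℝ (Fin 4) | (∀ j, (1 : ℝ) / 2 < holeTerm k j y) ∧
      levelFun k y ∈ Ioo (1 - 2 * V.ε) (1 + 2 * V.ε) ∧ V.Φ (1 - levelFun k y, y) ∈ range V.ν}
    rw [Q.ψ_jM a ha ha']
    exact (V.mem_flowTube_iff_of_mem ha).2 (image_subset_range _ _ hat)

/-- On the tube part the collar is the tube formula in tube coordinates. [folklore] -/
theorem collar_eq_fP_of_mem_tubeSet {p : Y × ℝ} (hp : p.1 ∈ V.tubeSet Q.jM) :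
    V.collar Q.jM Q.jB Q.ψ p = V.fP (V.ι (Q.ψ p.1), p.2) := by
  obtain ⟨y, σ⟩ := p
  obtain ⟨a, ⟨ha, ha', hat⟩, rfl⟩ := hp
  simp only
  rw [Q.ψ_jM a ha ha', ← cTube_eq_fP]
  by_cases hc : a ∈ V.unitTube
  · exact Q.collar_of_mem_unitTube ha ha' hc σ
  · rw [Q.collar_of_not_mem_unitTube ha hc]
    obtain ⟨⟨u, w⟩, ⟨-, hw⟩, hq⟩ := hat
    rw [mem_ball, dist_zero_right] at hw
    have hw1 : 1 ≤ ‖w‖ := by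
      by_contra h
      exact hc (hq ▸ (V.mem_unitTube_iff).2 (not_le.1 h).le)
    rw [← hq]
    exact V.cRad_eq_cTube u hw1 hw σ

/-- On the shell part the collar is the shell formula. [folklore] -/
theorem collar_eq_cRad_of_mem_radSet {p : Y × ℝ} (hp : p.1 ∈ V.radSet Q.jM) :
    V.collar Q.jM Q.jB Q.ψ p = V.cRad (Q.ψ p.1) p.2 := by
  obtain ⟨y, σ⟩ := p
  obtain ⟨a, ⟨ha, hat⟩, rfl⟩ := hp
  simp only
  rw [Q.ψ_jM a ha (fun h => hat (V.range_subset_unitTube h))]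
  exact Q.collar_of_not_mem_unitTube ha hat σ

/-- The flat part of `Y` is open. [folklore] -/
theorem isOpen_flatSetY : IsOpen (V.flatSetY Q.jB) :=
  Q.isOpenEmbedding_jB.isOpenMap _ (isOpen_lt (continuous_norm.comp (continuous_fst.comp continuous_subtype_val)) continuous_const)

/-- On the flat part the collar is the flat formula. [folklore] -/
theorem collar_eq_cFlat_of_mem_flatSetY {p : Y × ℝ} (hp : p.1 ∈ V.flatSetY Q.jB) :
    V.collar Q.jM Q.jB Q.ψ p = V.cFlat (TubeNbhd.invB Q.jB p.1) p.2 := by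
  obtain ⟨y, σ⟩ := p
  obtain ⟨⟨⟨pv, v⟩, hb⟩, hlt, rfl⟩ := hp
  simp only at hlt ⊢
  rw [Q.invB_jB]
  simp only
  by_cases hpv : pv = 0
  · subst hpv
    exact Q.collar_of_core v hb σ
  · have hlt1 : ‖pv‖ < 1 := (mem_solidTorus_iff (pv, v)).1 hb
    have hpos : 0 < ‖pv‖ := norm_pos_iff.2 hpv
    have hya := Q.jB_eq_jM ⟨(pv, v), hb⟩ hpv
    simp only at hya
    have hmem : V.ν (radialProjection (spherePt 1) pv, ‖pv‖ • (v : EuclideanSpace ℝ (Fin 2))) ∈ V.unitTube := by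
      rw [V.mem_unitTube_iff, norm_smul_coe_sphere hpos.le]; linarith [V.s₀_pos]
    rw [hya, Q.collar_of_mem_unitTube (V.ν_mem _) (V.ν_smul_not_mem_range hpos.ne' _ _) hmem]
    exact V.cTube_eq_cFlat hpv hlt.le v σ

/-- Points over the core circle of the surgery torus lie in the flat part. [folklore] -/
theorem mem_flatSetY_of_not_mem {p : Y × ℝ} (hp : p.1 ∉ V.mSet Q.jM) : p.1 ∈ V.flatSetY Q.jB := by
  obtain ⟨v, h, hy⟩ := Q.eq_jB_zero_of_not_mem hp
  refine ⟨⟨_, h⟩, ?_, hy⟩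
  show ‖(0 : EuclideanSpace ℝ (Fin 2))‖ < (1 - V.s₀) / 4
  rw [norm_zero]; linarith [V.depth₀_lt_one]

/-- Every point of `Y` is in the tube part, in the shell part, or off the `M_k`-part. [folklore] -/
theorem mem_tubeSet_or (y : Y) : y ∈ V.tubeSet Q.jM ∨ y ∈ V.radSet Q.jM ∨ y ∉ V.mSet Q.jM := by
  by_cases hy : y ∈ V.mSet Q.jM
  · obtain ⟨a, ⟨ha, ha'⟩, rfl⟩ := hy
    by_cases hat : a ∈ V.ν '' ((univ : Set (Metric.sphere (0 : EuclideanSpace ℝ (Fin 2)) 1)) ×ˢ ball (0 : EuclideanSpace ℝ (Fin 2)) 2)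
    · exact Or.inl ⟨a, ⟨ha, ha', hat⟩, rfl⟩
    · refine Or.inr (Or.inl ⟨a, ⟨ha, fun h => hat ?_⟩, rfl⟩)
      obtain ⟨⟨u, w⟩, ⟨-, hw⟩, hq⟩ := h
      rw [mem_closedBall, dist_zero_right] at hw
      exact ⟨(u, w), ⟨mem_univ _, by rw [mem_ball, dist_zero_right]; linarith⟩, hq⟩
  · exact Or.inr (Or.inr hy)

/-- **The collar is smooth.** [folklore] -/
theorem contMDiff_collar : ContMDiff ((𝓡 3).prod 𝓘(ℝ, ℝ)) 𝓘(ℝ, EuclideanSpace ℝ (Fin 4)) ∞ (V.collar Q.jM Q.jB Q.ψ) := by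
  intro p
  rcases Q.mem_tubeSet_or p.1 with hp | hp | hp
  · have hopen : IsOpen ((V.tubeSet Q.jM) ×ˢ (univ : Set ℝ)) := Q.isOpen_tubeSet.prod isOpen_univ
    have hev : V.collar Q.jM Q.jB Q.ψ =ᶠ[𝓝 p] fun p => V.fP (V.ι (Q.ψ p.1), p.2) := by
      filter_upwards [hopen.mem_nhds ⟨hp, mem_univ _⟩] with p' hp'
      exact Q.collar_eq_fP_of_mem_tubeSet hp'.1
    refine ContMDiffAt.congr_of_eventuallyEq ?_ hev
    have hco' : ContMDiffAt ((𝓡 3).prod 𝓘(ℝ, ℝ)) (((𝓡 1).prod 𝓘(ℝ, EuclideanSpace ℝ (Fin 2))).prod 𝓘(ℝ, ℝ)) ∞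
        (fun p : Y × ℝ => (V.ι (Q.ψ p.1), p.2)) p :=
      ((Q.contMDiffOn_coords.contMDiffAt (Q.isOpen_tubeSet.mem_nhds hp)).comp p contMDiffAt_fst).prodMk contMDiffAt_snd
    obtain ⟨a, ⟨ha, ha', ⟨⟨u, w⟩, ⟨-, hw⟩, hq⟩⟩, hpa⟩ := hp
    rw [mem_ball, dist_zero_right] at hw
    have hw0 : w ≠ 0 := by rintro rfl; exact ha' (by rw [← hq, V.ν_zero]; exact mem_range_self u)
    have hmem : (V.ι (Q.ψ p.1), p.2) ∈ (ConicalDiscTube.fPdom : Set (((Metric.sphere (0 : EuclideanSpace ℝ (Fin 2)) 1) × (EuclideanSpace ℝ (Fin 2))) × ℝ)) := by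
      rw [← hpa, Q.ψ_jM a ha ha', ← hq, V.ι_ν]
      exact ⟨hw0, hw⟩
    have hfP := V.contMDiffOn_fP.contMDiffAt (ConicalDiscTube.isOpen_fPdom.mem_nhds hmem)
    exact ContMDiffAt.comp (g := V.fP) (f := fun p : Y × ℝ => (V.ι (Q.ψ p.1), p.2)) p hfP hco'
  · -- shell part: `collar = cRad ∘ (ψ × id)`
    have hopen : IsOpen ((V.radSet Q.jM) ×ˢ (univ : Set ℝ)) := Q.isOpen_radSet.prod isOpen_univ
    have hev : V.collar Q.jM Q.jB Q.ψ =ᶠ[𝓝 p] fun p => V.cRad (Q.ψ p.1) p.2 := by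
      filter_upwards [hopen.mem_nhds ⟨hp, mem_univ _⟩] with p' hp'
      exact Q.collar_eq_cRad_of_mem_radSet hp'.1
    refine ContMDiffAt.congr_of_eventuallyEq ?_ hev
    obtain ⟨a, ⟨ha, hat⟩, hpa⟩ := hp
    have ha' : a ∉ range V.K₁ := fun h => hat (V.range_subset_unitTube h)
    have hco : ContMDiffAt ((𝓡 3).prod 𝓘(ℝ, ℝ)) 𝓘(ℝ, (EuclideanSpace ℝ (Fin 4)) × ℝ) ∞ (fun p : Y × ℝ => (Q.ψ p.1, p.2)) p :=
      ((Q.contMDiffAt_ψ ⟨a, ⟨ha, ha'⟩, hpa⟩).comp p contMDiffAt_fst).prodMk_space contMDiffAt_snd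
    exact ContMDiffAt.comp (g := fun q : (EuclideanSpace ℝ (Fin 4)) × ℝ => V.cRad q.1 q.2) (f := fun p : Y × ℝ => (Q.ψ p.1, p.2)) p
      V.contDiff_cRad.contMDiff.contMDiffAt hco
  · -- flat part: `collar = cFlat ∘ (invB × id)`
    have hmem : p.1 ∈ V.flatSetY Q.jB := Q.mem_flatSetY_of_not_mem hp
    have hopen : IsOpen ((V.flatSetY Q.jB) ×ˢ (univ : Set ℝ)) := Q.isOpen_flatSetY.prod isOpen_univ
    have hev : V.collar Q.jM Q.jB Q.ψ =ᶠ[𝓝 p] fun p => V.cFlat (TubeNbhd.invB Q.jB p.1) p.2 := by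
      filter_upwards [hopen.mem_nhds ⟨hmem, mem_univ _⟩] with p' hp'
      exact Q.collar_eq_cFlat_of_mem_flatSetY hp'.1
    refine ContMDiffAt.congr_of_eventuallyEq ?_ hev
    have hrange : p.1 ∈ range Q.jB := image_subset_range _ _ hmem
    have hco : ContMDiffAt ((𝓡 3).prod 𝓘(ℝ, ℝ)) ((𝓘(ℝ, EuclideanSpace ℝ (Fin 2)).prod (𝓡 1)).prod 𝓘(ℝ, ℝ)) ∞
        (fun p : Y × ℝ => (TubeNbhd.invB Q.jB p.1, p.2)) p :=
      ((Q.contMDiffOn_invB.contMDiffAt (Q.isOpen_range_jB.mem_nhds hrange)).comp p contMDiffAt_fst).prodMk contMDiffAt_snd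
    have hmem' : (TubeNbhd.invB Q.jB p.1, p.2) ∈ {q : ((EuclideanSpace ℝ (Fin 2)) × (Metric.sphere (0 : EuclideanSpace ℝ (Fin 2)) 1)) × ℝ | ‖q.1.1‖ < 4⁻¹} := by
      obtain ⟨b, hb, hby⟩ := hmem
      show ‖(TubeNbhd.invB Q.jB p.1).1‖ < 4⁻¹
      rw [← hby, Q.invB_jB]
      have : ‖(b : (EuclideanSpace ℝ (Fin 2)) × (Metric.sphere (0 : EuclideanSpace ℝ (Fin 2)) 1)).1‖ < (1 - V.s₀) / 4 := hb
      linarith [V.s₀_pos]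
    have hfF := V.contMDiffOn_cFlat.contMDiffAt ((isOpen_lt (continuous_norm.comp (continuous_fst.comp continuous_fst))
      continuous_const).mem_nhds hmem')
    exact ContMDiffAt.comp (g := fun q : ((EuclideanSpace ℝ (Fin 2)) × (Metric.sphere (0 : EuclideanSpace ℝ (Fin 2)) 1)) × ℝ => V.cFlat q.1 q.2)
      (f := fun p : Y × ℝ => (TubeNbhd.invB Q.jB p.1, p.2)) p hfF hco

end Pres

end CollarDatum

end FriendsVk

/-- **Helper `helper_friendsCarrier_Vk_partC_smooth`** (registered piece 5 of `helper_friendsCarrier_Vk_partC`,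
line `mk_friends`, crux `DcrGap`): under the hypotheses of part C, the collar `c : Y × ℝ → ℝ⁴` of the
uninverted model disc exterior is a `C^∞` INJECTIVE map with OPEN image in `ℝ⁴ ∖ (D_k ∪ Δ)`
(Kirby 1989, Ch. I §5; Manolescu–Piccirillo 2023, §3.2). [cite: Kirby1989, Ch. I §5] -/
theorem helper_friendsCarrier_Vk_partC_smooth : ∀ (k : ℕ) (K₁ : (sphere (0 : EuclideanSpace ℝ (Fin 2)) 1) → EuclideanSpace ℝ (Fin 4)) (Φ : ℝ × EuclideanSpace ℝ (Fin 4) → EuclideanSpace ℝ (Fin 4)) (ε s₁ s₀ : ℝ) (g : EuclideanSpace ℝ (Fin 2) → EuclideanSpace ℝ (Fin 4)) (G : EuclideanSpace ℝ (Fin 2) × EuclideanSpace ℝ (Fin 2) → EuclideanSpace ℝ (Fin 4)) (ν : (sphere (0 : EuclideanSpace ℝ (Fin 2)) 1) × EuclideanSpace ℝ (Fin 2) → EuclideanSpace ℝ (Fin 4)), IsModelKnot k K₁ → ContDiff ℝ ∞ Φ → (∀ x, Φ (0, x) = x) → (∀ s t x, Φ (s, Φ (t, x)) = Φ (s + t,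 x)) → 0 < ε → ε ≤ 1 / 4 → (∀ x ∈ modelBoundary k, ∀ s : ℝ, |s| ≤ 2 * ε → (∀ j, (1 : ℝ) / 2 < holeTerm k j (Φ (s, x))) ∧ levelFun k (Φ (s, x)) = 1 + s) → (∀ y, (∀ j, 0 < holeTerm k j y) → |levelFun k y - 1| < 2 * ε → Φ (1 - levelFun k y, y) ∈ modelBoundary k) → 0 < s₀ → s₀ < s₁ → s₁ < 2 * ε → IsModelSliceDisc k K₁ g → (∀ (u : (sphere (0 : EuclideanSpace ℝ (Fin 2)) 1)) (t : ℝ), 1 - s₁ ≤ t → t ≤ 1 → g (t • (u : EuclideanSpace ℝ (Fin 2))) = Φ (1 - t, K₁ u)) → (ContDiffOn ℝ ∞ G (ball 0 1 ×ˢ ball 0 2) ∧ InjOn G (ball 0 1 ×ˢ ball 0 2) ∧ (∀ q ∈ ball 0 1 ×ˢ ball 0 2, Injective (fderiv ℝ G q)) ∧ (∀ q ∈ ball 0 1 ×ˢ ball 0 2, G q ∉ modelHandlebody k) ∧ (∀ x ∈ ball 0 1, G (x, 0) = g x)) → (∀ (u : (sphere (0 : EuclideanSpace ℝ (Fin 2))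 1)) (t : ℝ) (w : EuclideanSpace ℝ (Fin 2)), 1 - s₁ < t → t < 1 → ‖w‖ < 2 → G (t • (u : EuclideanSpace ℝ (Fin 2)), w) = Φ (1 - t, ν (u, w))) → (∀ (x w : EuclideanSpace ℝ (Fin 2)), ‖x‖ ≤ 1 - s₀ → ‖w‖ < 2 → ∀ a ∈ modelBoundary k, ∀ s : ℝ, 0 < s → s < s₀ → G (x, w) ≠ Φ (s, a)) → ∀ (Y : Type) [TopologicalSpace Y] [T2Space Y] [SecondCountableTopology Y] [ChartedSpace (EuclideanSpace ℝ (Fin 3)) Y] [IsManifold (𝓡 3) ∞ Y] (jB : solidTorus → Y) (jM : EuclideanSpace ℝ (Fin 4) → Y) (W : Set (EuclideanSpace ℝ (Fin 4))) (ψ : Y → EuclideanSpace ℝ (Fin 4)), (Manifold.IsSmoothEmbedding (𝓘(ℝ, EuclideanSpace ℝ (Fin 2)).prod (𝓡 1)) (𝓡 3) ∞ jB ∧ IsOpen (range jB) ∧ ContMDiff ((𝓡 1).prod 𝓘(ℝ, EuclideanSpace ℝ (Fin 2))) 𝓘(ℝ, EuclideanSpace ℝ (Fin 4)) ∞ ν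 ∧ Injective ν ∧ (∀ p, Injective (mfderiv ((𝓡 1).prod 𝓘(ℝ, EuclideanSpace ℝ (Fin 2))) 𝓘(ℝ, EuclideanSpace ℝ (Fin 4)) ν p)) ∧ (∀ p, ν p ∈ modelBoundary k) ∧ (∀ u : (sphere (0 : EuclideanSpace ℝ (Fin 2)) 1), ν (u, 0) = K₁ u) ∧ IsOpen W ∧ (∀ x ∈ modelBoundary k, x ∉ range K₁ → x ∈ W) ∧ ContMDiffOn 𝓘(ℝ, EuclideanSpace ℝ (Fin 4)) (𝓡 3) ∞ jM W ∧ IsOpen (jM '' {x : EuclideanSpace ℝ (Fin 4) | x ∈ modelBoundary k ∧ x ∉ range K₁}) ∧ ContMDiffOn (𝓡 3) 𝓘(ℝ, EuclideanSpace ℝ (Fin 4)) ∞ ψ (jM '' {x : EuclideanSpace ℝ (Fin 4) | x ∈ modelBoundary k ∧ x ∉ range K₁}) ∧ (∀ x ∈ modelBoundary k, x ∉ range K₁ → ψ (jM x) = x) ∧ jM '' {x : EuclideanSpace ℝ (Fin 4) | x ∈ modelBoundary k ∧ x ∉ range K₁} ∪ range jB = univ ∧ (∀ x ∈ modelBoundary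 k, x ∉ range K₁ → ∀ b : solidTorus, jM x = jB b ↔ ∃ (u : (sphere (0 : EuclideanSpace ℝ (Fin 2)) 1)) (t : ℝ), t ∈ Ioo (0 : ℝ) 1 ∧ b.1.1 = t • (u : EuclideanSpace ℝ (Fin 2)) ∧ x = ν (u, t • (b.1.2 : EuclideanSpace ℝ (Fin 2))))) → ∃ c : Y × ℝ → EuclideanSpace ℝ (Fin 4), ContMDiff ((𝓡 3).prod 𝓘(ℝ, ℝ)) 𝓘(ℝ, EuclideanSpace ℝ (Fin 4)) ∞ c ∧ Injective c ∧ IsOpen (range c) ∧ ∀ z ∈ range c, z ∉ modelHandlebody k ∧ z ∉ g '' closedBall 0 1 := by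
  intro k K₁ Φ ε s₁ s₀ g G ν hK hΦ hΦ0 hΦadd hε hε4 hclock hband hs₀ hs₀₁ hs₁ε hg hgcone hG hGcone hdeep Y _ _ _ _ _ jB jM W ψ
    ⟨h1, h2, h3, h4, h5, h6, h7, h8, h9, h10, h11, h12, h13, h14, h15⟩
  let V : FriendsVk.CollarDatum k :=
    FriendsVk.CollarDatum.datumOf hK hΦ hΦ0 hΦadd hε hε4 hclock hband hs₀ hs₀₁ hs₁ε hg hgcone hG hGcone hdeep h3 h4 h5 h6 h7
  obtain ⟨Q, hQM, hQB, hQψ⟩ := FriendsVk.CollarDatum.Pres.ofHyp_spec V h1 h2 h8 h9 h10 h11 h12 h13 h14 h15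
  refine ⟨V.collar Q.jM Q.jB Q.ψ, Q.contMDiff_collar, Q.collar_injective, ?_, ?_⟩
  · rw [Q.range_collar]; exact V.isOpen_region
  · rw [Q.range_collar]; exact fun z hz => V.region_subset_O hz

end Summit.SmoothPoincare4.SmoothPoincare4.Theorems.DcrGap.MkFriends

end
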